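import Summits.CriticalPhenomena.CardyFormulaZ2.Theses.CardySelfRefinement
import Literature.Probability.Percolation.QuadCrossingSpaceZ2
import Literature.Probability.Percolation.QuadCrossingNoiseDiscrete
import Literature.Probability.Percolation.QuadCrossingSpaceProofs
import Literature.Probability.Percolation.InterfaceCurves
import Summits.CriticalPhenomena.CardyFormulaZ2.Theorems.LagHandOff.Negative.Structure
import HarnessLib

/-!
# Joint events of two interface readings pass to the limit: partial helper for stub
`stub_freeAxioms` of line `crosscut-dictionary` for crux `LagHandOff` (stmt-CriticalPhenomena-10268)

Measure-theoretic input of the LOCALITY conjuncts (`ChordalFamily.IsLocal`,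
`ChordalFamily.IsTargetIndependent`) of the registered stub `stub_freeAxioms` (namespace
`Summit.CriticalPhenomena.CardyFormulaZ2.Cruxes.LagHandOff.CrosscutDictionary`).  The hand-off
hypothesis of the stub gives, for EACH Dobrushin domain separately, joint convergence in law of
(quad configuration, interface) to `(S, Ψ D S)`, `S ∼ μ`.  Locality compares the interfaces of
TWO domains `D₁`, `D₂` read off the SAME configuration `ω`; this file shows that the two separate
joint convergences already control the PAIR `(Ψ D₁ S, Ψ D₂ S)`:

* `tendsto_integral_mul_of_joint` — `E[h₁(Yₙ) h₂(Zₙ)] → ∫ h₁(f S) h₂(g S) dμ` for bounded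
  continuous `h₁`, `h₂` whenever `(Xₙ, Yₙ) ⇒ (S, f S)` and `(Xₙ, Zₙ) ⇒ (S, g S)`: replace `h₁(Yₙ)`
  by `u(Xₙ)` with `u` bounded continuous and `∫ |h₁ ∘ f - u| dμ` small (bounded continuous
  functions are dense in `L¹(μ)` on the compact metrizable `ℋ_ℂ`, Schramm–Smirnov Thm 1.4 +
  Mathlib's `Integrable.exists_boundedContinuous_integral_sub_le`), the error being controlled by
  the first convergence tested on `|h₁(y) - u(S)|`, then use the second convergence on
  `u(S) h₂(z)`;
* `ae_mem_of_joint_of_isClosed` — hence a CLOSED set of pairs of curve classes that contains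
  `(Yₙ ω, Zₙ ω)` for every `ω` and all large `n` contains `(f S, g S)` for `μ`-a.e. `S` (cover the
  complement by countably many boxes of balls around a dense sequence, test each box by a
  product of bumps);
* `measurable_bondInterfaceIn_of_family` — the interfaces of a discretisation family are Borel at
  positive mesh (finitely many domain edges: the refuter's `Negative.measurable_bondInterfaceIn`),
  so that the integrals above are honest;
* the registered sub-stub `stub_freeAxioms_jointReadings` — the percolation instance: closed,
  eventually sure joint events of the interfaces of two discretised Dobrushin domains pass to the
  pair of hand-off readings.

References: P. Billingsley, Convergence of Probability Measures (1999) §2–3 (weak convergence,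
couplings through a common coordinate); O. Schramm, S. Smirnov, Ann. Probab. 39 (2011) Thm 1.4
(`ℋ_ℂ` compact metrizable).
-/

noncomputable section

open MeasureTheory Filter Set Topology
open scoped BoundedContinuousFunction unitInterval ENNReal
open Literature.Probability.Percolation Literature.Probability.LatticeModels
open Literature.Probability.RandomPlanarGeometry Literature.Probability.Percolation.QuadCrossing
open Summit.CriticalPhenomena.CardyFormulaZ2.Theses.CardySelfRefinement

namespace Summit.CriticalPhenomena.CardyFormulaZ2.Cruxes.LagHandOff.CrosscutDictionary

/-! ### Measurability of the interface at positive mesh -/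

/-- **The interface of a discretisation family is measurable at every positive mesh** (the
domain is bounded, so `Ω_δ` has finitely many edges and the interface factors through finitely
many edge coordinates, `Negative.measurable_bondInterfaceIn`; cf. `Negative.lagHandOff_clause_i`). -/
theorem measurable_bondInterfaceIn_of_family (D : DobrushinDomain) {E : ℝ → DiscreteDobrushin}
    (hE : ZdDiscretisationFamily D E) {δ : ℝ} (hδ : 0 < δ) :
    Measurable (bondInterfaceIn D (E δ)) := by
  refine Summit.CriticalPhenomena.CardyFormulaZ2.Theorems.LagHandOff.Negative.measurable_bondInterfaceIn
    D (E δ) ?_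
  have hV : (meshDomain (E δ).Ω (E δ).δ).Finite := hE.meshDomain_finite hδ
  refine ((hV.prod hV).image (fun p : Site 2 × Site 2 => s(p.1, p.2))).subset ?_
  intro e he
  induction e using Sym2.ind with
  | _ x y =>
    have hadj := (SimpleGraph.mem_edgeSet _).1 he
    have h := discreteDomainGraph_adj_iff.1 hadj
    exact ⟨(x, y), ⟨h.2.1, h.2.2⟩, rfl⟩

/-! ### Joint convergence of two readings of the same configuration -/

/-- Bounded measurable real functions are integrable against a finite measure. -/
theorem integrable_of_abs_le {α : Type*} [MeasurableSpace α] {ν : Measure α} [IsFiniteMeasure ν]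
    {φ : α → ℝ} (hφ : Measurable φ) (C : ℝ) (h : ∀ x, |φ x| ≤ C) : Integrable φ ν :=
  Integrable.of_bound hφ.aestronglyMeasurable C
    (Eventually.of_forall fun x => by rw [Real.norm_eq_abs]; exact h x)

/-- `|∫ a c - ∫ b c| ≤ M ∫ |a - b|` for `|c| ≤ M`. -/
theorem abs_integral_mul_sub_le {α : Type*} [MeasurableSpace α] {ν : Measure α}
    {a b c : α → ℝ} (hac : Integrable (fun x => a x * c x) ν)
    (hbc : Integrable (fun x => b x * c x) ν) (hab : Integrable (fun x => |a x - b x|) ν)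
    {M : ℝ} (hc : ∀ x, |c x| ≤ M) :
    |∫ x, a x * c x ∂ν - ∫ x, b x * c x ∂ν| ≤ M * ∫ x, |a x - b x| ∂ν := by
  rw [← integral_sub hac hbc, ← integral_const_mul]
  refine abs_integral_le_integral_abs.trans (integral_mono (hac.sub hbc).abs (hab.const_mul M)
    fun x => ?_)
  show |a x * c x - b x * c x| ≤ M * |a x - b x|
  rw [← sub_mul, abs_mul, mul_comm]
  exact mul_le_mul_of_nonneg_right (hc x) (abs_nonneg _)

/-- **Products of test functions of two readings converge.** If `(Xₙ, Yₙ) ⇒ (S, f S)` and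
`(Xₙ, Zₙ) ⇒ (S, g S)` (same `Xₙ`, same limit law `μ` of `S` on `ℋ_ℂ`), then
`E[h₁(Yₙ) h₂(Zₙ)] → ∫ h₁(f S) h₂(g S) dμ` for bounded continuous `h₁`, `h₂`: replace `h₁(Yₙ)` by
`u(Xₙ)` for a bounded continuous `u` with `∫ |h₁ ∘ f - u| dμ` small (continuous functions are
dense in `L¹(μ)` on the compact metrizable `ℋ_ℂ`), at a cost controlled by the FIRST joint
convergence tested on `|h₁(y) - u(S)|`, and apply the SECOND joint convergence to
`u(S) h₂(z)`. -/
theorem tendsto_integral_mul_of_joint {Ω' : Type*} [MeasurableSpace Ω'] {P : Measure Ω'}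
    [IsFiniteMeasure P] {μ : Measure (QuadConfig (Set.univ : Set ℂ))} [IsFiniteMeasure μ]
    {X : ℕ → Ω' → QuadConfig (Set.univ : Set ℂ)} {Y Z : ℕ → Ω' → CurveClass ℂ}
    {f g : QuadConfig (Set.univ : Set ℂ) → CurveClass ℂ}
    (hX : ∀ n, Measurable (X n)) (hY : ∀ n, Measurable (Y n)) (hZ : ∀ n, Measurable (Z n))
    (hf : Measurable f) (hg : Measurable g)
    (hXY : ∀ Φ : (QuadConfig (Set.univ : Set ℂ) × CurveClass ℂ) →ᵇ ℝ,
      Tendsto (fun n => ∫ ω, Φ (X n ω, Y n ω) ∂P) atTop (𝓝 (∫ S, Φ (S, f S) ∂μ)))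
    (hXZ : ∀ Φ : (QuadConfig (Set.univ : Set ℂ) × CurveClass ℂ) →ᵇ ℝ,
      Tendsto (fun n => ∫ ω, Φ (X n ω, Z n ω) ∂P) atTop (𝓝 (∫ S, Φ (S, g S) ∂μ)))
    (h₁ h₂ : CurveClass ℂ →ᵇ ℝ) :
    Tendsto (fun n => ∫ ω, h₁ (Y n ω) * h₂ (Z n ω) ∂P) atTop
      (𝓝 (∫ S, h₁ (f S) * h₂ (g S) ∂μ)) := by
  haveI : T2Space (QuadConfig (Set.univ : Set ℂ)) :=
    (SchrammSmirnov2011_thm_1_4_holds Set.univ isOpen_univ Set.univ_nonempty).1.2.2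
  haveI : TopologicalSpace.MetrizableSpace (QuadConfig (Set.univ : Set ℂ)) :=
    (SchrammSmirnov2011_thm_1_4_holds Set.univ isOpen_univ Set.univ_nonempty).1.2.1
  haveI : CompactSpace (QuadConfig (Set.univ : Set ℂ)) := QuadConfig.compactSpace
  haveI : NormalSpace (QuadConfig (Set.univ : Set ℂ)) := inferInstance
  have hM : ∀ x, |h₂ x| ≤ ‖h₂‖ := fun x => by
    rw [← Real.norm_eq_abs]; exact h₂.norm_coe_le_norm x
  have hM0 : 0 ≤ ‖h₂‖ := norm_nonneg _
  rw [Metric.tendsto_nhds]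
  intro ε hε
  set ε' : ℝ := ε / (4 * (‖h₂‖ + 1)) with hε'
  have hε'pos : 0 < ε' := by positivity
  have hMε : ‖h₂‖ * ε' ≤ ε / 4 := by
    have h1 : ‖h₂‖ * ε' = ε / 4 * (‖h₂‖ / (‖h₂‖ + 1)) := by
      rw [hε']; field_simp
    rw [h1]
    have h2 : ‖h₂‖ / (‖h₂‖ + 1) ≤ 1 := div_le_one_of_le₀ (by linarith) (by positivity)
    have h3 : 0 ≤ ε / 4 := by positivity
    nlinarith
  -- `L¹(μ)` approximation of `h₁ ∘ f` by a bounded continuous `u`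
  have hint : Integrable (fun S => h₁ (f S)) μ :=
    integrable_of_abs_le (h₁.continuous.measurable.comp hf) ‖h₁‖ fun S => by
      rw [← Real.norm_eq_abs]; exact h₁.norm_coe_le_norm (f S)
  obtain ⟨u, hu, -⟩ := hint.exists_boundedContinuous_integral_sub_le hε'pos
  simp only [Real.norm_eq_abs] at hu
  -- the two test functions
  set Φ₁ : (QuadConfig (Set.univ : Set ℂ) × CurveClass ℂ) →ᵇ ℝ :=
    (h₁.compContinuous ⟨Prod.snd, continuous_snd⟩ -
      u.compContinuous ⟨Prod.fst, continuous_fst⟩).normComp with hΦ₁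
  set Φ₂ : (QuadConfig (Set.univ : Set ℂ) × CurveClass ℂ) →ᵇ ℝ :=
    u.compContinuous ⟨Prod.fst, continuous_fst⟩ * h₂.compContinuous ⟨Prod.snd, continuous_snd⟩
    with hΦ₂
  have hΦ₁_apply : ∀ (S : QuadConfig (Set.univ : Set ℂ)) (y : CurveClass ℂ),
      Φ₁ (S, y) = |h₁ y - u S| := by
    intro S y
    simp only [hΦ₁, BoundedContinuousFunction.coe_normComp, Function.comp_apply,
      BoundedContinuousFunction.coe_sub, Pi.sub_apply,
      BoundedContinuousFunction.compContinuous_apply, ContinuousMap.coe_mk, Real.norm_eq_abs]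
  have hΦ₂_apply : ∀ (S : QuadConfig (Set.univ : Set ℂ)) (z : CurveClass ℂ),
      Φ₂ (S, z) = u S * h₂ z := by
    intro S z
    simp only [hΦ₂, BoundedContinuousFunction.coe_mul, Pi.mul_apply,
      BoundedContinuousFunction.compContinuous_apply, ContinuousMap.coe_mk]
  have hlim₁ := hXY Φ₁
  have hlim₂ := hXZ Φ₂
  simp only [hΦ₁_apply] at hlim₁
  simp only [hΦ₂_apply] at hlim₂
  have hev₁ : ∀ᶠ n in atTop, ∫ ω, |h₁ (Y n ω) - u (X n ω)| ∂P < 2 * ε' := by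
    have hlt : ∫ S, |h₁ (f S) - u S| ∂μ < 2 * ε' := by linarith
    exact hlim₁ (Iio_mem_nhds hlt)
  have hev₂ : ∀ᶠ n in atTop,
      dist (∫ ω, u (X n ω) * h₂ (Z n ω) ∂P) (∫ S, u S * h₂ (g S) ∂μ) < ε / 4 :=
    Metric.tendsto_nhds.1 hlim₂ (ε / 4) (by positivity)
  filter_upwards [hev₁, hev₂] with n hn₁ hn₂
  rw [Real.dist_eq] at hn₂ ⊢
  -- integrability bookkeeping
  have hb₁ : ∀ y, |h₁ y| ≤ ‖h₁‖ := fun y => by rw [← Real.norm_eq_abs]; exact h₁.norm_coe_le_norm y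
  have hbu : ∀ S, |u S| ≤ ‖u‖ := fun S => by rw [← Real.norm_eq_abs]; exact u.norm_coe_le_norm S
  have hm₁ : ∀ n, Measurable fun ω => h₁ (Y n ω) := fun n => h₁.continuous.measurable.comp (hY n)
  have hm₂ : ∀ n, Measurable fun ω => h₂ (Z n ω) := fun n => h₂.continuous.measurable.comp (hZ n)
  have hmu : ∀ n, Measurable fun ω => u (X n ω) := fun n => u.continuous.measurable.comp (hX n)
  have hI1 : Integrable (fun ω => h₁ (Y n ω) * h₂ (Z n ω)) P :=
    integrable_of_abs_le ((hm₁ n).mul (hm₂ n)) (‖h₁‖ * ‖h₂‖) fun ω => by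
      rw [abs_mul]; exact mul_le_mul (hb₁ _) (hM _) (abs_nonneg _) (norm_nonneg _)
  have hI2 : Integrable (fun ω => u (X n ω) * h₂ (Z n ω)) P :=
    integrable_of_abs_le ((hmu n).mul (hm₂ n)) (‖u‖ * ‖h₂‖) fun ω => by
      rw [abs_mul]; exact mul_le_mul (hbu _) (hM _) (abs_nonneg _) (norm_nonneg _)
  have hI3 : Integrable (fun ω => |h₁ (Y n ω) - u (X n ω)|) P :=
    integrable_of_abs_le ((hm₁ n).sub (hmu n)).abs (‖h₁‖ + ‖u‖) fun ω => by
      rw [abs_abs]; exact (abs_sub _ _).trans (add_le_add (hb₁ _) (hbu _))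
  have hJ1 : Integrable (fun S => u S * h₂ (g S)) μ :=
    integrable_of_abs_le (u.continuous.measurable.mul (h₂.continuous.measurable.comp hg))
      (‖u‖ * ‖h₂‖) fun S => by
      rw [abs_mul]; exact mul_le_mul (hbu _) (hM _) (abs_nonneg _) (norm_nonneg _)
  have hJ2 : Integrable (fun S => h₁ (f S) * h₂ (g S)) μ :=
    integrable_of_abs_le ((h₁.continuous.measurable.comp hf).mul
      (h₂.continuous.measurable.comp hg)) (‖h₁‖ * ‖h₂‖) fun S => by
      rw [abs_mul]; exact mul_le_mul (hb₁ _) (hM _) (abs_nonneg _) (norm_nonneg _)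
  have hJ3 : Integrable (fun S => |u S - h₁ (f S)|) μ :=
    integrable_of_abs_le (u.continuous.measurable.sub (h₁.continuous.measurable.comp hf)).abs
      (‖u‖ + ‖h₁‖) fun S => by
      rw [abs_abs]; exact (abs_sub _ _).trans (add_le_add (hbu _) (hb₁ _))
  have hA : |∫ ω, h₁ (Y n ω) * h₂ (Z n ω) ∂P - ∫ ω, u (X n ω) * h₂ (Z n ω) ∂P| ≤
      ‖h₂‖ * ∫ ω, |h₁ (Y n ω) - u (X n ω)| ∂P := abs_integral_mul_sub_le hI1 hI2 hI3 fun ω => hM _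
  have hB : |∫ S, u S * h₂ (g S) ∂μ - ∫ S, h₁ (f S) * h₂ (g S) ∂μ| ≤
      ‖h₂‖ * ∫ S, |u S - h₁ (f S)| ∂μ := abs_integral_mul_sub_le hJ1 hJ2 hJ3 fun S => hM _
  have hB' : ∫ S, |u S - h₁ (f S)| ∂μ ≤ ε' := by
    simpa only [abs_sub_comm] using hu
  have hA' : ‖h₂‖ * ∫ ω, |h₁ (Y n ω) - u (X n ω)| ∂P ≤ ‖h₂‖ * (2 * ε') :=
    mul_le_mul_of_nonneg_left hn₁.le hM0
  have hB'' : ‖h₂‖ * ∫ S, |u S - h₁ (f S)| ∂μ ≤ ‖h₂‖ * ε' := mul_le_mul_of_nonneg_left hB' hM0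
  have htri := abs_sub_le (∫ ω, h₁ (Y n ω) * h₂ (Z n ω) ∂P) (∫ ω, u (X n ω) * h₂ (Z n ω) ∂P)
    (∫ S, h₁ (f S) * h₂ (g S) ∂μ)
  have htri' := abs_sub_le (∫ ω, u (X n ω) * h₂ (Z n ω) ∂P) (∫ S, u S * h₂ (g S) ∂μ)
    (∫ S, h₁ (f S) * h₂ (g S) ∂μ)
  linarith

/-- **Closed, eventually sure JOINT events of two readings pass to the limit.** In the
setting of `tendsto_integral_mul_of_joint`, a closed set `K` of PAIRS of curve classes
containing `(Yₙ ω, Zₙ ω)` for every `ω` and all large `n` contains `(f S, g S)` for `μ`-a.e.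
`S` (cover the open complement by countably many boxes of balls around a dense sequence and
test each box with a product of two bumps). -/
theorem ae_mem_of_joint_of_isClosed {Ω' : Type*} [MeasurableSpace Ω'] {P : Measure Ω'}
    [IsFiniteMeasure P] {μ : Measure (QuadConfig (Set.univ : Set ℂ))} [IsFiniteMeasure μ]
    {X : ℕ → Ω' → QuadConfig (Set.univ : Set ℂ)} {Y Z : ℕ → Ω' → CurveClass ℂ}
    {f g : QuadConfig (Set.univ : Set ℂ) → CurveClass ℂ}
    (hX : ∀ n, Measurable (X n)) (hY : ∀ n, Measurable (Y n)) (hZ : ∀ n, Measurable (Z n))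
    (hf : Measurable f) (hg : Measurable g)
    (hXY : ∀ Φ : (QuadConfig (Set.univ : Set ℂ) × CurveClass ℂ) →ᵇ ℝ,
      Tendsto (fun n => ∫ ω, Φ (X n ω, Y n ω) ∂P) atTop (𝓝 (∫ S, Φ (S, f S) ∂μ)))
    (hXZ : ∀ Φ : (QuadConfig (Set.univ : Set ℂ) × CurveClass ℂ) →ᵇ ℝ,
      Tendsto (fun n => ∫ ω, Φ (X n ω, Z n ω) ∂P) atTop (𝓝 (∫ S, Φ (S, g S) ∂μ)))
    {K : Set (CurveClass ℂ × CurveClass ℂ)} (hK : IsClosed K)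
    (hev : ∀ᶠ n in atTop, ∀ ω, (Y n ω, Z n ω) ∈ K) :
    ∀ᵐ S ∂μ, (f S, g S) ∈ K := by
  haveI : Nonempty (CurveClass ℂ) := ⟨CurveClass.mk (Curve.const 0)⟩
  obtain ⟨q, hq⟩ := TopologicalSpace.exists_dense_seq (CurveClass ℂ)
  -- bumps: `bump p r x = max 0 (r - dist x p)`
  have hbump : ∀ (p : CurveClass ℂ) (r : ℝ), 0 < r → ∃ b : CurveClass ℂ →ᵇ ℝ,
      (∀ x, 0 ≤ b x) ∧ ∀ x, b x ≠ 0 ↔ dist x p < r := by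
    intro p r hr
    refine ⟨BoundedContinuousFunction.mkOfBound ⟨fun x => max 0 (r - dist x p),
      continuous_const.max (continuous_const.sub (continuous_id.dist continuous_const))⟩ r
      fun x y => ?_, fun x => le_max_left _ _, fun x => ⟨fun hx => ?_, fun hx => ?_⟩⟩
    · simp only [ContinuousMap.coe_mk, Real.dist_eq]
      have hx0 : 0 ≤ max 0 (r - dist x p) := le_max_left _ _
      have hy0 : 0 ≤ max 0 (r - dist y p) := le_max_left _ _
      have hx1 : max 0 (r - dist x p) ≤ r :=
        max_le hr.le (by linarith [dist_nonneg (x := x) (y := p)])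
      have hy1 : max 0 (r - dist y p) ≤ r :=
        max_le hr.le (by linarith [dist_nonneg (x := y) (y := p)])
      exact abs_sub_le_iff.2 ⟨by linarith, by linarith⟩
    · have hx' : max 0 (r - dist x p) ≠ 0 := hx
      by_contra hge
      exact hx' (max_eq_left (by linarith [not_lt.1 hge]))
    · show max 0 (r - dist x p) ≠ 0
      exact (lt_max_of_lt_right (sub_pos.2 hx)).ne'
  -- one box at a time
  have key : ∀ i j m : ℕ,
      Disjoint (Metric.ball (q i) (1 / ((m : ℝ) + 1)) ×ˢ Metric.ball (q j) (1 / ((m : ℝ) + 1))) K →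
      ∀ᵐ S ∂μ, ¬ (f S ∈ Metric.ball (q i) (1 / ((m : ℝ) + 1)) ∧
        g S ∈ Metric.ball (q j) (1 / ((m : ℝ) + 1))) := by
    intro i j m hdisj
    have hr : (0 : ℝ) < 1 / ((m : ℝ) + 1) := by positivity
    obtain ⟨b₁, hb₁0, hb₁⟩ := hbump (q i) _ hr
    obtain ⟨b₂, hb₂0, hb₂⟩ := hbump (q j) _ hr
    have hlim := tendsto_integral_mul_of_joint hX hY hZ hf hg hXY hXZ b₁ b₂
    have hzero : ∫ S, b₁ (f S) * b₂ (g S) ∂μ = 0 := by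
      refine tendsto_nhds_unique hlim (tendsto_const_nhds.congr' ?_)
      filter_upwards [hev] with n hn
      refine (integral_eq_zero_of_ae (Eventually.of_forall fun ω => ?_)).symm
      show b₁ (Y n ω) * b₂ (Z n ω) = 0
      by_contra hne
      exact Set.disjoint_left.1 hdisj ⟨(hb₁ _).1 (left_ne_zero_of_mul hne),
        (hb₂ _).1 (right_ne_zero_of_mul hne)⟩ (hn ω)
    have hint : Integrable (fun S => b₁ (f S) * b₂ (g S)) μ :=
      integrable_of_abs_le ((b₁.continuous.measurable.comp hf).mul
        (b₂.continuous.measurable.comp hg)) (‖b₁‖ * ‖b₂‖) fun S => by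
        rw [abs_mul, ← Real.norm_eq_abs, ← Real.norm_eq_abs]
        exact mul_le_mul (b₁.norm_coe_le_norm _) (b₂.norm_coe_le_norm _) (norm_nonneg _)
          (norm_nonneg _)
    have hae := (integral_eq_zero_iff_of_nonneg (fun S => mul_nonneg (hb₁0 _) (hb₂0 _)) hint).1
      hzero
    filter_upwards [hae] with S hS
    rintro ⟨h1, h2⟩
    simp only [Pi.zero_apply, mul_eq_zero] at hS
    rcases hS with h | h
    · exact (hb₁ _).2 (Metric.mem_ball.1 h1) h
    · exact (hb₂ _).2 (Metric.mem_ball.1 h2) h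
  -- all boxes at once
  have hall : ∀ᵐ S ∂μ, ∀ i j m : ℕ,
      Disjoint (Metric.ball (q i) (1 / ((m : ℝ) + 1)) ×ˢ Metric.ball (q j) (1 / ((m : ℝ) + 1))) K →
      ¬ (f S ∈ Metric.ball (q i) (1 / ((m : ℝ) + 1)) ∧
        g S ∈ Metric.ball (q j) (1 / ((m : ℝ) + 1))) := by
    refine ae_all_iff.2 fun i => ae_all_iff.2 fun j => ae_all_iff.2 fun m => ?_
    by_cases hd : Disjoint (Metric.ball (q i) (1 / ((m : ℝ) + 1)) ×ˢ
        Metric.ball (q j) (1 / ((m : ℝ) + 1))) K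
    · filter_upwards [key i j m hd] with S hS
      exact fun _ => hS
    · exact Eventually.of_forall fun S h => absurd h hd
  filter_upwards [hall] with S hS
  by_contra hSK
  obtain ⟨ε, hε, hball⟩ := Metric.isOpen_iff.1 hK.isOpen_compl (f S, g S) hSK
  obtain ⟨m, hm⟩ := exists_nat_one_div_lt (half_pos hε)
  obtain ⟨i, hi⟩ := hq.exists_dist_lt (f S) (by positivity : (0 : ℝ) < 1 / ((m : ℝ) + 1))
  obtain ⟨j, hj⟩ := hq.exists_dist_lt (g S) (by positivity : (0 : ℝ) < 1 / ((m : ℝ) + 1))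
  refine hS i j m ?_ ⟨Metric.mem_ball.2 hi, Metric.mem_ball.2 hj⟩
  rw [Set.disjoint_left]
  rintro ⟨y, z⟩ ⟨hy, hz⟩ hyzK
  refine hball ?_ hyzK
  rw [Metric.mem_ball, Prod.dist_eq, max_lt_iff]
  have hy' := Metric.mem_ball.1 hy
  have hz' := Metric.mem_ball.1 hz
  have h1 := dist_triangle y (q i) (f S)
  have h2 := dist_triangle z (q j) (g S)
  rw [dist_comm (q i) (f S)] at h1
  rw [dist_comm (q j) (g S)] at h2
  exact ⟨by simp only; linarith, by simp only; linarith⟩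

/-! ### The percolation instance (registered sub-stub) -/

/-- **Registered sub-stub `stub_freeAxioms_jointReadings`.** Closed, eventually sure joint
events of the interfaces of two discretised Dobrushin domains, read off the same configuration
at meshes `δs n > 0`, pass to the pair of hand-off readings `(Ψ D₁ S, Ψ D₂ S)` for `μ`-a.e. `S`. -/
theorem stub_freeAxioms_jointReadings : ∀ (Ψ : DobrushinDomain → QuadConfig (Set.univ : Set ℂ) → CurveClass ℂ) (μ : FiniteMeasure (QuadConfig (Set.univ : Set ℂ))) (δs : ℕ → ℝ), (∀ n, 0 < δs n) → ∀ (D₁ D₂ : DobrushinDomain) (E₁ E₂ : ℝ → DiscreteDobrushin), ZdDiscretisationFamily D₁ E₁ → ZdDiscretisationFamily D₂ E₂ → Measurable (Ψ D₁) → Measurable (Ψ D₂) → (∀ f : (QuadConfig (Set.univ : Set ℂ) × CurveClass ℂ) →ᵇ ℝ, Tendsto (fun n => ∫ ω, f (z2QuadConfig (Set.univ : Set ℂ) (δs n) ω, bondInterfaceIn D₁ (E₁ (δs n)) ω) ∂(bondPercolation (zdGraph 2) half)) atTop (𝓝 (∫ S, f (S, Ψ D₁ S) ∂(μ : Measure (QuadConfig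 (Set.univ : Set ℂ)))))) → (∀ f : (QuadConfig (Set.univ : Set ℂ) × CurveClass ℂ) →ᵇ ℝ, Tendsto (fun n => ∫ ω, f (z2QuadConfig (Set.univ : Set ℂ) (δs n) ω, bondInterfaceIn D₂ (E₂ (δs n)) ω) ∂(bondPercolation (zdGraph 2) half)) atTop (𝓝 (∫ S, f (S, Ψ D₂ S) ∂(μ : Measure (QuadConfig (Set.univ : Set ℂ)))))) → ∀ K : Set (CurveClass ℂ × CurveClass ℂ), IsClosed K → (∀ᶠ n in atTop, ∀ ω : BondConfig (Site 2), (bondInterfaceIn D₁ (E₁ (δs n)) ω, bondInterfaceIn D₂ (E₂ (δs n)) ω) ∈ K) → ∀ᵐ S ∂(μ : Measure (QuadConfig (Set.univ : Set ℂ))), (Ψ D₁ S, Ψ D₂ S) ∈ K :=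
  fun _ _ _ hpos D₁ D₂ _ _ hE₁ hE₂ hΨ₁ hΨ₂ h3₁ h3₂ _ hK hev =>
    ae_mem_of_joint_of_isClosed (P := bondPercolation (zdGraph 2) half)
      (fun n => measurable_z2QuadConfig isOpen_univ (hpos n))
      (fun n => measurable_bondInterfaceIn_of_family D₁ hE₁ (hpos n))
      (fun n => measurable_bondInterfaceIn_of_family D₂ hE₂ (hpos n)) hΨ₁ hΨ₂ h3₁ h3₂ hK hev

end Summit.CriticalPhenomena.CardyFormulaZ2.Cruxes.LagHandOff.CrosscutDictionary

end
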